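import Summits.QuantumFields.YangMills.Theorems.BalabanUVNodesN11OmegaTopStepWeight
import Summits.QuantumFields.YangMills.Theorems.BalabanUVNodesN11TopChildTStep
import Summits.QuantumFields.YangMills.Theorems.BalabanUVNodesN11TStepBranchSumOldIndex

/-!
# DAG node N11 — 11a's `𝐓_{k+1}(s′)` AND def-T's SLOTS AT EVERY CHILD WITH `Ω_{k+1}(s′) = 𝕋`: NO V-integration is left (the V-bond sets `B_k(Ω^c_{k+1})`, `B_{k+1}(Ω^c_{k+1})` are EMPTY),
# only generation `k`'s A-integral over `B_k(Λ^c_{k+1})` and the `Y`-sum over the admissible `S_{k+1} ⊆ Λ^c_{k+1}`: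
# `𝐓_{k+1}(s′)[W] Φ (V′) = Σ_Y ζ_k(∅)(base V′) · ∫ dA_k|_{Λ^c_{k+1}} χ(Λ^c_{k+1}, Y) e^{−½⟨A_k, 𝒬_k(Λ_{k+1}) A_k⟩} · (Π_{j<k} ζ_j(∅)·w_j(𝕋,∅,∅)) · Φ(S_Y, A_k)` — (3.23)'s shape with NO δ-function left;
# so the (O3′) clause at such a child is ONE explicit identity in the new field: a one-step transport on the old side, a finite-dimensional Lebesgue integral of `exp A_{k+1}` on the new side

HEADER — WORK-UNIT METADATA.  Cell `pub-ymgap`, YM-PLAN Track A (HUMAN RULING D-0062), seat `pub-ymgap-dag-n11-d` (g18; N11 [B14], s2), route `BalabanUVNodes`, item K1⁹ =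
stmt-QuantumFields-27364 (helper lane, `--kind proof --supports 27364 --as helper`, count-neutral).  [III] = [Balaban1988Convergent], [I] = [Balaban1987RG1].  Over this seat's g18
`…N11OmegaTopStepWeight` (def-T's step weight at such children), `…N11TopChildTStep` (the all-small generations are scalars; `transportOfRecord_const_mul`), g15's `…N11TStepBranchSumOldIndex`
(`sum_admSOfRecord_succ`, `tkBranchOfRecord_update_succ_eq_init`) and def-T's 11a∕11c∕FILE 1.

WHY THIS FILE.  The frozen-`y` road of g17 (conditional expectations on ONE fibre of the inside variables) is what the (O3′) clause needs when the child RETAINS old variables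
(`Ω_{k+1} ⊊ 𝕋`).  When `Ω_{k+1}(s′) = 𝕋` — no new large PLAQUETTE-field region; these children and the top child carry the whole weight of the (3.2)∕(3.3)-small configurations — NOTHING is
retained: 11a's generation `k` has empty V-bond sets, its V-factor is the identity (`vOp_kernelRT_of_isEmpty`), and `𝐓_{k+1}(s′)` is `ζ_k(∅) ·` ONE A-integral per admissible new
large-fluctuation region `Y ⊆ Λ^c_{k+1}` of (scalars ×) the operand.  The (O3′) identity at such a child is therefore chart-free and fibre-free in its STATEMENT: def-T's one-step transport
of `χ′_k(ALL)·(Σ_{R,S} ζ)·χ_k slot_k` on the old side, `ζ_k(∅) · Σ_Y ∫ dA_k χ(Λ^c, Y) e^{−½ quad} (…) exp A_{k+1}(s′; t′, (S_Y, A_k), E′)` on the new side — [III] (3.23)–(3.25) at these children,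
[I] §§2–3 + [II] + [III] Thm 2 being the CONTENT (not proved here).  The top child (`Λ_{k+1} = 𝕋`: `Y = ∅` only, no A-variables) is `…N11TopChildTStep`'s special case.

WHAT THIS FILE PROVES (0 `def`, 0 `sorry`, standard axioms; generic `V`, `W`).  §1 `genOp_genDataOfRecord_of_Omega_univ` (the generation at `Ω_{j+1} = 𝕋` is `ζ_j ·` its A-factor) ·
`Seq_init_allSmall_of_Omega_succ_univ` ∕ `admSOfRecord_init_of_Omega_succ_univ` ((2.1): below such a child the history is all-small; its `{S_j}`-index is the empty branch) ·
★★ `TkOfRecord_succ_of_Omega_univ` (the display above, `{hdec}` unified with 11a's classical instance).  §2 with n02-b's step weights: ★★ `slotsTOfRecord_succ_eq_of_Omega_univ[_of_chiSeq_ne_zero]`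
(def-T's pre-𝐑 slot: the (3.2) front product pulled out ∕ `= 1` on the support) · ★★ `sect2Slot_eq_of_Omega_univ` (11c's §2-form slot there) · ★★★ `O3_iff_of_Omega_univ` (the (O3′)-shaped
clause at such a child ↔ ONE explicit identity in `V′`).

HONEST FRAMING.  Kernel bookkeeping over def-T's ∕ n02-b's definitions (count-neutral); the identity is DISPLAYED as an equivalence of shapes, NOT proved; nothing of Bałaban asserted;
the scalars `ζ_j(∅)·w_j(𝕋,∅,∅)` (`j < k`) and `ζ_k(∅)` at the base configuration are the witness's residual data, displayed, not evaluated; N11 NOT discharged; K1⁹ NOT closed; no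
registered stub touched; counts unmoved (typed 28∕28 · discharged 5∕27 · A 5∕28).  One finite `𝕋⁴_{L^K}` programme at fixed `ε = L^{−K}` — NOT ℝ⁴, NOT OS, NOT a mass gap, NOT Clay.
No `sorry`, `axiom`, `def`, `instance`, `notation`.  Sources (SHAPE only): [III] (2.1) p.254, (2.18) p.257, (2.20)–(2.23) p.258, (3.1) p.264, (3.2)–(3.5) p.265, (3.16) p.268,
(3.20)–(3.21) p.269, (3.23)–(3.25) p.270, Thm 1 p.262, Thm 2 p.263; [I] Thm 1 p.259, §2 p.267, §3 p.272.
-/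

noncomputable section

open MeasureTheory
open scoped BigOperators Matrix.Norms.L2Operator

namespace Summit.QuantumFields.YangMills.Theorems.BalabanUVNodesN11OmegaTopTStep

open Literature.MathematicalPhysics.QuantumFieldTheory.Balaban1983to89 T4Continuum Node00 Node00.Tk B14.Eq218Concrete B14.Sect3Decomp
open B10Eq42TorusConstraint (bondsIn)
open BalabanUVNodesN11TopChildStepWeight (Seq_Λ_eq_univ_of_Ω_succ_eq_univ prod_chiFactor_eq_one_of_chiSeq_top_ne_zero)
open BalabanUVNodesN11TopChildTStep (isEmpty_sV_of_Omega_univ isEmpty_sV'_of_Omega_univ tkBranchOfRecord_of_allSmall transportOfRecord_const_mul)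
open BalabanUVNodesN11OmegaTopStepWeight (wOfRecord_eq_prod_of_Omega_univ)
open BalabanUVNodesN11TStepBranchSumOldIndex (sum_admSOfRecord_succ tkBranchOfRecord_update_succ_eq_init)

variable {F : T4Family} {N : ℕ} [NeZero N]

/-! ## §1. 11a at a child with `Ω_{k+1} = 𝕋`: the V-factor is the identity, the history below is all-small -/

section Generation

variable (V : Type) (ν : Stage7Numerics) (M : ℕ) (g : ℕ → ℝ) (K : ℕ) (W : TkWeights F N V K)
  [NormedAddCommGroup V] [InnerProductSpace ℝ V] [FiniteDimensional ℝ V] [MeasurableSpace V] [BorelSpace V]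

/-- **A GENERATION OF 11a WITH `Ω_{j+1}(s) = 𝕋` IS `ζ_j(Ω^c_{j+1}) ·` ITS A-FACTOR**: the V-bond sets are empty, the restricted kernel transport over them is the identity
(`vOp_kernelRT_of_isEmpty`); the A-integral over `B_j(Λ^c_{j+1} ∩ Ω_{j+1})` with weight `χ(Λ^c_{j+1} ∩ Ω_{j+1}, S_{j+1}) e^{−½ quad_j(Λ_{j+1})}` remains. [cite: Balaban1988Convergent, (2.21)–(2.22) p.258, (3.23) p.270] -/
theorem genOp_genDataOfRecord_of_Omega_univ {k : ℕ} (s : SeqOfRecord F ν M g K k) (S : ℕ → Set (Site (F.P K) 0)) (j : ℕ) {hdec : DecidableEq (PBond (F.P K) j)}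
    (hΩ : s.Ω (j + 1) = Set.univ) (Φ : MultiCfg (F.P K) (SU N) V → ℝ) (ω : MultiCfg (F.P K) (SU N) V) :
    genOp j (genDataOfRecord F N V ν M g K W s S j) Φ ω =
      W.ζ j (s.Ω (j + 1))ᶜ ω * aOp j (genDataOfRecord F N V ν M g K W s S j).sA (genDataOfRecord F N V ν M g K W s S j).w Φ ω := by
  haveI := isEmpty_sV_of_Omega_univ V ν M g K W s S j (hdec := hdec) hΩ
  haveI := isEmpty_sV'_of_Omega_univ V ν M g K W s S j (hdec := hdec) hΩ
  rw [genOp_apply]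
  change vOp j (genDataOfRecord F N V ν M g K W s S j).sV (genDataOfRecord F N V ν M g K W s S j).sV'
      (kernelRT (avgRestrOfRecord F N K j (genDataOfRecord F N V ν M g K W s S j).sV (genDataOfRecord F N V ν M g K W s S j).sV')) _ ω = _
  rw [vOp_kernelRT_of_isEmpty _ _ _ _ (measurable_avgRestrOfRecord (F := F) (N := N) K j _ _), zetaOp_apply]
  rfl

omit [NeZero N] in
/-- **(2.1): BELOW A CHILD WITH `Ω_{k+1} = 𝕋` THE HISTORY IS ALL-SMALL** (`Ω_{k+1} ⊆ Λ_k ⊆ Λ_j ⊆ Ω_j` for `j ≤ k`). [cite: Balaban1988Convergent, (2.1) p.254] -/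
theorem Seq_init_allSmall_of_Omega_succ_univ {k : ℕ} (s' : SeqOfRecord F ν M g K (k + 1)) (hΩ : s'.Ω (k + 1) = Set.univ) :
    ∀ j, 1 ≤ j → j ≤ k → s'.init.Ω j = Set.univ ∧ s'.init.Λ j = Set.univ := fun j h1 hj => by
  have hΛk : s'.Λ k = Set.univ := Seq_Λ_eq_univ_of_Ω_succ_eq_univ F ν M ⟨K, 0, 0⟩ g k s' hΩ (h1.trans hj)
  have hΛj : s'.Λ j = Set.univ := Set.eq_univ_of_univ_subset (hΛk ▸ s'.chain.Λ_antitone h1 hj (Nat.le_succ k))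
  rw [Seq.init_Ω s' h1 hj, Seq.init_Λ s' h1 hj]
  exact ⟨Set.eq_univ_of_univ_subset (hΛj ▸ s'.chain.Λ_subset j h1 (Nat.le_succ_of_le hj)), hΛj⟩

/-- … hence its `{S_j}`-index is the all-empty branch alone. [cite: Balaban1988Convergent, (2.1) p.254] -/
theorem admSOfRecord_init_of_Omega_succ_univ {k : ℕ} (s' : SeqOfRecord F ν M g K (k + 1)) (hΩ : s'.Ω (k + 1) = Set.univ) :
    admSOfRecord F ν M g K k s'.init = {fun _ => (∅ : Set (Site (F.P K) 0))} :=
  admSOfRecord_of_eq F ν M g K k s'.init fun j h1 hj => by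
    rw [(Seq_init_allSmall_of_Omega_succ_univ ν M g K s' hΩ j h1 hj).1, (Seq_init_allSmall_of_Omega_succ_univ ν M g K s' hΩ j h1 hj).2]

/-- ★★ **11a's `𝐓_{k+1}(s′)` AT A CHILD WITH `Ω_{k+1}(s′) = 𝕋`**:
`𝐓_{k+1}(s′)[W] Φ (V′) = Σ_{Y} ζ_k(Ω^c_{k+1})(base V′) · ∫ dA_k|_{B_k(Λ^c_{k+1} ∩ Ω_{k+1})} [w_k(Λ_{k+1}, Λ^c_{k+1} ∩ Ω_{k+1}, Y) · (Π_{j<k} ζ_j(∅)·w_j(𝕋,∅,∅)) · Φ(S_Y, ·)](base V′ with A_k inserted)`,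
`Y` over the admissible new regions (S-class at `k+1`, `Y ⊆ Ω_{k+1} ∩ Λ^c_{k+1}`), `S_Y = (∅,…,∅,Y)` — (2.18)'s index at `k+1` over the all-small history (`sum_admSOfRecord_succ`, the old index is the
empty branch), the old generations scalars (`tkBranchOfRecord_of_allSmall`), the new generation `ζ_k ·` A-factor (§1).  `{hdec}` is unified with 11a's classical instance.
[cite: Balaban1988Convergent, (2.18) p.257, (2.20)–(2.22) p.258, (3.23)–(3.24) p.270] -/
theorem TkOfRecord_succ_of_Omega_univ {k : ℕ} (s' : SeqOfRecord F ν M g K (k + 1)) (hΩ : s'.Ω (k + 1) = Set.univ)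
    (Φ : SFluct (F.P K) V → B15DeterminingSets.MSField (F.P K) (SU N) → ℝ) (V' : GaugeField (F.P K) (k + 1) (SU N)) {hdec : DecidableEq (PBond (F.P K) k)} :
    TkOfRecord F N V ν M g K W (k + 1) s' Φ V' =
      ∑ Y ∈ (Set.toFinite {Y : Set (Site (F.P K) 0) | Y ∈ SClassOfRecord F ν g K (k + 1) ∧ Y ⊆ s'.Ω (k + 1) ∩ (s'.Λ (k + 1))ᶜ}).toFinset,
        W.ζ k (s'.Ω (k + 1))ᶜ (baseCfg (k + 1) V') *
          aOp k (genDataOfRecord F N V ν M g K W s' (Function.update (fun _ => ∅) (k + 1) Y) k).sA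
            (genDataOfRecord F N V ν M g K W s' (Function.update (fun _ => ∅) (k + 1) Y) k).w
            (fun ω => (∏ j ∈ Finset.range k, W.ζ j ∅ ω * W.w j Set.univ ∅ ∅ ω) *
              Φ (Function.update (fun _ => ∅) (k + 1) Y, fun j => (ω j).2) (fun j => (ω j).1)) (baseCfg (k + 1) V') := by
  obtain rfl : hdec = fun a b => Classical.propDecidable (a = b) := Subsingleton.elim _ _
  rw [TkOfRecord_apply, sum_admSOfRecord_succ, admSOfRecord_init_of_Omega_succ_univ ν M g K s' hΩ, Finset.sum_singleton]
  refine Finset.sum_congr rfl fun Y _ => ?_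
  have hall := Seq_init_allSmall_of_Omega_succ_univ ν M g K s' hΩ
  have hbr : tkBranchOfRecord F N V ν M g K W s' (Function.update (fun _ => (∅ : Set (Site (F.P K) 0))) (k + 1) Y) k
        (fun ω => Φ (Function.update (fun _ => ∅) (k + 1) Y, fun j => (ω j).2) (fun j => (ω j).1)) =
      fun ω => (∏ j ∈ Finset.range k, W.ζ j ∅ ω * W.w j Set.univ ∅ ∅ ω) *
        Φ (Function.update (fun _ => ∅) (k + 1) Y, fun j => (ω j).2) (fun j => (ω j).1) := by
    funext ω
    rw [tkBranchOfRecord_update_succ_eq_init,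
      tkBranchOfRecord_of_allSmall V ν M g K W s'.init (fun _ => ∅) k (fun j hj => hall (j + 1) (Nat.succ_pos j) (Nat.succ_le_of_lt hj)) _ ω]
  rw [tkBranchOfRecord_succ, hbr, genOp_genDataOfRecord_of_Omega_univ V ν M g K W s' _ k hΩ]

end Generation

/-! ## §2. def-T's slots at a child with `Ω_{k+1} = 𝕋` with n02-b's step weights; the (O3′)-shaped clause there as ONE explicit identity -/

section Slots

variable (F N) (ν : Stage7Numerics) (τ : TowerNumerics) (E : B12.RunParams → ℝ) (A₁ : ℝ) (ζ : ZetaOfRecord F N ν τ.M) (ppSel : PpSelOfRecord F ν τ.M)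
  (p : B12.RunParams) (g : ℕ → ℝ) (k : ℕ)

open Classical in
/-- ★★ **def-T's PRE-𝐑 SLOT AT A CHILD WITH `Ω_{k+1}(s′) = 𝕋`**:
`slotT_{k+1}(s′)(V′) = (Π_{□′} χ_{□′}(V′)) · ∫dU δ(ŪV′⁻¹) [χ′_k(ALL cubes)(U,V′) · (Σ_R [Λ(R) = Λ_{k+1}(s′)] Σ_S ζ_{k+1}(∅,∅,(R,S))(U,V′)) · χ_k(init s′)(U) · slot_k(init s′)(U)]` — the (3.2) front product leaves the
transport. [cite: Balaban1988Convergent, (3.1) p.264, (3.2)–(3.5) p.265, (3.16) p.268, (3.20)–(3.21) p.269, (3.24)–(3.25) p.270] -/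
theorem slotsTOfRecord_succ_eq_of_Omega_univ (hD : 0 < sideD F ν τ.M p g k) (s' : SeqOfRecord F ν τ.M g p.K (k + 1)) (hΩ : s'.Ω (k + 1) = Set.univ)
    (V' : GaugeField (F.P p.K) (k + 1) (SU N)) :
    slotsTOfRecord F N ν τ E (wOfRecord F N ν τ.M A₁ ζ) ppSel p g (k + 1) s' V' =
      (∏ c : Iχ F ν p g k, chiFactor F N ν p g k c V') *
        transportOfRecord F N p.K k (fun U =>
          chiPrime (sect3DataOfRecord F N ν τ.M p g k s'.init) (avOfRecord F N p.K) (2 * deltaOfRecord ν g k A₁) (Finset.univ : Finset (Iχ F ν p g k)) U V' *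
            (∑ R : Finset (Iχ F ν p g k), ∑ S : Finset (Iχ F ν p g k),
              if LambdaOfLabel F ν τ.M p g k s'.init (∅, ∅, (R, ∅)) = s'.Λ (k + 1) then ζ p g k s'.init ∅ ∅ (R, S) U V' else 0) *
            (chiSeqOfRecord F N ν τ.M g p.K k s'.init U * slotsOfRecord F N ν τ E (wOfRecord F N ν τ.M A₁ ζ) ppSel p g k s'.init U)) V' := by
  rw [slotsTOfRecord_succ_apply]
  have hfun : (fun U => wOfRecord F N ν τ.M A₁ ζ p g k s' U V' *
        (chiSeqOfRecord F N ν τ.M g p.K k s'.init U * slotsOfRecord F N ν τ E (wOfRecord F N ν τ.M A₁ ζ) ppSel p g k s'.init U)) =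
      fun U => (∏ c : Iχ F ν p g k, chiFactor F N ν p g k c V') *
        (chiPrime (sect3DataOfRecord F N ν τ.M p g k s'.init) (avOfRecord F N p.K) (2 * deltaOfRecord ν g k A₁) (Finset.univ : Finset (Iχ F ν p g k)) U V' *
            (∑ R : Finset (Iχ F ν p g k), ∑ S : Finset (Iχ F ν p g k),
              if LambdaOfLabel F ν τ.M p g k s'.init (∅, ∅, (R, ∅)) = s'.Λ (k + 1) then ζ p g k s'.init ∅ ∅ (R, S) U V' else 0) *
            (chiSeqOfRecord F N ν τ.M g p.K k s'.init U * slotsOfRecord F N ν τ E (wOfRecord F N ν τ.M A₁ ζ) ppSel p g k s'.init U)) := by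
    funext U
    rw [wOfRecord_eq_prod_of_Omega_univ F N ν τ.M A₁ p g k ζ hD s' hΩ U V']
    ring
  rw [hfun, transportOfRecord_const_mul]

open Classical in
/-- ★★ **… AND ON THE `χ_{k+1}`-SUPPORT THE FRONT PRODUCT IS `1`.** [cite: Balaban1988Convergent, (3.1) p.264, (3.2)–(3.3) p.265, (3.25) p.270] -/
theorem slotsTOfRecord_succ_eq_of_Omega_univ_of_chiSeq_ne_zero (hD : 0 < sideD F ν τ.M p g k) (s' : SeqOfRecord F ν τ.M g p.K (k + 1)) (hΩ : s'.Ω (k + 1) = Set.univ)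
    (V' : GaugeField (F.P p.K) (k + 1) (SU N)) (hχ : chiSeqOfRecord F N ν τ.M g p.K (k + 1) s' V' ≠ 0) :
    slotsTOfRecord F N ν τ E (wOfRecord F N ν τ.M A₁ ζ) ppSel p g (k + 1) s' V' =
      transportOfRecord F N p.K k (fun U =>
        chiPrime (sect3DataOfRecord F N ν τ.M p g k s'.init) (avOfRecord F N p.K) (2 * deltaOfRecord ν g k A₁) (Finset.univ : Finset (Iχ F ν p g k)) U V' *
          (∑ R : Finset (Iχ F ν p g k), ∑ S : Finset (Iχ F ν p g k),
            if LambdaOfLabel F ν τ.M p g k s'.init (∅, ∅, (R, ∅)) = s'.Λ (k + 1) then ζ p g k s'.init ∅ ∅ (R, S) U V' else 0) *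
          (chiSeqOfRecord F N ν τ.M g p.K k s'.init U * slotsOfRecord F N ν τ E (wOfRecord F N ν τ.M A₁ ζ) ppSel p g k s'.init U)) V' := by
  rw [slotsTOfRecord_succ_eq_of_Omega_univ F N ν τ E A₁ ζ ppSel p g k hD s' hΩ V', prod_chiFactor_eq_one_of_chiSeq_top_ne_zero F N ν τ.M p g k s' hΩ V' hχ, one_mul]

variable {𝔸 : Type*} [NormedRing 𝔸] [NormedAlgebra ℂ 𝔸] [CompleteSpace 𝔸]

/-- ★★ **11c's §2-FORM SLOT AT A CHILD WITH `Ω_{k+1}(s′) = 𝕋`**: `sect2Slot … s′ t E′ U (V′) = Σ_Y ζ_k(∅)(base V′) · ∫ dA_k|_{B_k(Λ^c_{k+1})} [w_k(Λ_{k+1}, Λ^c_{k+1}, Y) · (Π_{j<k} ζ_j(∅) w_j(𝕋,∅,∅)) ·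
exp A_{k+1}(s′; t, (S_Y, A), E′)(U(·))]` — the NEW large-fluctuation variables integrated against (3.23)'s weight, the new action evaluated; no δ-function.
[cite: Balaban1988Convergent, (2.18) p.257, (2.23) p.258, (3.23)–(3.25) p.270] -/
theorem sect2Slot_eq_of_Omega_univ (Sg : Sect2.Setting 𝔸 (SU N)) (Rz : Sect2.Residual (F.P p.K) 𝔸) (W : TkWeights F N (FluctV N) p.K)
    (s' : SeqOfRecord F ν τ.M g p.K (k + 1)) (hΩ : s'.Ω (k + 1) = Set.univ) (t : Sect2.TermValues (F.P p.K) 𝔸 (FluctV N) τ.M) (E' : ℝ) (U : BgMap F N p.K)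
    (V' : GaugeField (F.P p.K) (k + 1) (SU N)) {hdec : DecidableEq (PBond (F.P p.K) k)} :
    sect2Slot F N (FluctV N) p.K Sg Rz W s' t E' U V' =
      ∑ Y ∈ (Set.toFinite {Y : Set (Site (F.P p.K) 0) | Y ∈ SClassOfRecord F ν g p.K (k + 1) ∧ Y ⊆ s'.Ω (k + 1) ∩ (s'.Λ (k + 1))ᶜ}).toFinset,
        W.ζ k (s'.Ω (k + 1))ᶜ (baseCfg (k + 1) V') *
          aOp k (genDataOfRecord F N (FluctV N) ν τ.M g p.K W s' (Function.update (fun _ => ∅) (k + 1) Y) k).sA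
            (genDataOfRecord F N (FluctV N) ν τ.M g p.K W s' (Function.update (fun _ => ∅) (k + 1) Y) k).w
            (fun ω => (∏ j ∈ Finset.range k, W.ζ j ∅ ω * W.w j Set.univ ∅ ∅ ω) *
              sect2Operand F N (FluctV N) p.K Sg Rz s' t E' U (Function.update (fun _ => ∅) (k + 1) Y, fun j => (ω j).2) (fun j => (ω j).1))
            (baseCfg (k + 1) V') :=
  TkOfRecord_succ_of_Omega_univ (FluctV N) ν τ.M g p.K W s' hΩ _ V' (hdec := hdec)

/-- ★★★ **THE (O3′)-SHAPED CLAUSE AT A CHILD WITH `Ω_{k+1}(s′) = 𝕋` IS ONE EXPLICIT IDENTITY IN THE NEW FIELD**: def-T's slot family with n02-b's weights, 11a's weights `W`, 11c's §2-form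
slot with ANY term values ∕ constant ∕ background map:
«`slotT_{k+1}(s′) = 0 ∨ ∀ᵐ V′, χ_{k+1}(s′)(V′) ≠ 0 → slotT_{k+1}(s′)(V′) = sect2Slot … s′ t E′ U (V′)`» `↔`
«`slotT_{k+1}(s′) = 0 ∨ ∀ᵐ V′, χ_{k+1}(s′)(V′) ≠ 0 → ∫dU δ(ŪV′⁻¹)[χ′_k(ALL)·Σ_{R,S}[Λ(R)=Λ_{k+1}(s′)]ζ_{k+1}(∅,∅,(R,S))·χ_k slot_k(init s′)](V′) = Σ_Y ζ_k(∅)(base V′)·∫dA_k|_{Λ^c}[w_k(Λ,Λ^c,Y)·Π_{j<k}(ζ_j w_j)·exp A_{k+1}(s′;t,(S_Y,A),E′)]`»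
— [III] (3.23)–(3.25) at these children ([I] §§2–3 + [II] + Thm 2 behind it), no δ-function, no frozen variable, no chart in the STATEMENT.
[cite: Balaban1988Convergent, Thm 1 p.262, Thm 2 p.263, (3.1) p.264, (3.23)–(3.25) p.270, (2.18) p.257, (2.21)–(2.23) p.258; Balaban1987RG1, Thm 1 p.259] -/
theorem O3_iff_of_Omega_univ (Sg : Sect2.Setting 𝔸 (SU N)) (Rz : Sect2.Residual (F.P p.K) 𝔸) (W : TkWeights F N (FluctV N) p.K)
    (hD : 0 < sideD F ν τ.M p g k) (s' : SeqOfRecord F ν τ.M g p.K (k + 1)) (hΩ : s'.Ω (k + 1) = Set.univ)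
    (t : Sect2.TermValues (F.P p.K) 𝔸 (FluctV N) τ.M) (E' : ℝ) (U : BgMap F N p.K) {hdec : DecidableEq (PBond (F.P p.K) k)} :
    (slotsTOfRecord F N ν τ E (wOfRecord F N ν τ.M A₁ ζ) ppSel p g (k + 1) s' = 0 ∨
      ∀ᵐ V' ∂fieldMeasure (F.P p.K) (k + 1) (SU N), chiSeqOfRecord F N ν τ.M g p.K (k + 1) s' V' ≠ 0 →
        slotsTOfRecord F N ν τ E (wOfRecord F N ν τ.M A₁ ζ) ppSel p g (k + 1) s' V' = sect2Slot F N (FluctV N) p.K Sg Rz W s' t E' U V') ↔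
    (slotsTOfRecord F N ν τ E (wOfRecord F N ν τ.M A₁ ζ) ppSel p g (k + 1) s' = 0 ∨
      ∀ᵐ V' ∂fieldMeasure (F.P p.K) (k + 1) (SU N), chiSeqOfRecord F N ν τ.M g p.K (k + 1) s' V' ≠ 0 →
        transportOfRecord F N p.K k (fun U =>
            chiPrime (sect3DataOfRecord F N ν τ.M p g k s'.init) (avOfRecord F N p.K) (2 * deltaOfRecord ν g k A₁) (Finset.univ : Finset (Iχ F ν p g k)) U V' *
              (∑ R : Finset (Iχ F ν p g k), ∑ S : Finset (Iχ F ν p g k),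
                if LambdaOfLabel F ν τ.M p g k s'.init (∅, ∅, (R, ∅)) = s'.Λ (k + 1) then ζ p g k s'.init ∅ ∅ (R, S) U V' else 0) *
              (chiSeqOfRecord F N ν τ.M g p.K k s'.init U * slotsOfRecord F N ν τ E (wOfRecord F N ν τ.M A₁ ζ) ppSel p g k s'.init U)) V' =
          ∑ Y ∈ (Set.toFinite {Y : Set (Site (F.P p.K) 0) | Y ∈ SClassOfRecord F ν g p.K (k + 1) ∧ Y ⊆ s'.Ω (k + 1) ∩ (s'.Λ (k + 1))ᶜ}).toFinset,
            W.ζ k (s'.Ω (k + 1))ᶜ (baseCfg (k + 1) V') *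
              aOp k (genDataOfRecord F N (FluctV N) ν τ.M g p.K W s' (Function.update (fun _ => ∅) (k + 1) Y) k).sA
                (genDataOfRecord F N (FluctV N) ν τ.M g p.K W s' (Function.update (fun _ => ∅) (k + 1) Y) k).w
                (fun ω => (∏ j ∈ Finset.range k, W.ζ j ∅ ω * W.w j Set.univ ∅ ∅ ω) *
                  sect2Operand F N (FluctV N) p.K Sg Rz s' t E' U (Function.update (fun _ => ∅) (k + 1) Y, fun j => (ω j).2) (fun j => (ω j).1))
                (baseCfg (k + 1) V')) := by
  classical
  refine or_congr_right (Filter.eventually_congr (Filter.Eventually.of_forall fun V' => ?_))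
  refine imp_congr_right fun hχ => ?_
  rw [slotsTOfRecord_succ_eq_of_Omega_univ_of_chiSeq_ne_zero F N ν τ E A₁ ζ ppSel p g k hD s' hΩ V' hχ,
    sect2Slot_eq_of_Omega_univ F N ν τ p g k Sg Rz W s' hΩ t E' U V' (hdec := hdec)]

end Slots

end Summit.QuantumFields.YangMills.Theorems.BalabanUVNodesN11OmegaTopTStep

end
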